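import Literature.MathematicalPhysics.QuantumFieldTheory.BalabanImbrieJaffe1984to88.BIJ88RT51Invariant
import Literature.MathematicalPhysics.QuantumFieldTheory.BalabanImbrieJaffe1984to88.BIJ88Eq44OneStroke

/-!
# `BalabanImbrieJaffe1984to88.BIJ88RT51Background` — T. Bałaban, J. Imbrie, A. Jaffe, *Effective action and cluster properties of the
abelian Higgs model*, Commun. Math. Phys. **114** (1988) 257–315 [BalabanImbrieJaffe1988], (4.4) p. 274, (4.17) p. 277, (5.1.1)/(5.1.4)
pp. 277–278: **the BACKGROUND scalar kernel `Q(u_k)φ` of the renormalization transformation (5.1.1) made CONCRETE** — the covariant block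
average (2.6) of [2] whose parallel transports are computed from `ū_k`, the product (4.4) of the η-lattice background field `u_k` along the
unit-lattice bonds — and the two printed consequences of *"u_k transforms by λ"* PROVED for it: pointed INVARIANCE ((5.1.4) *"Since u_k also
transforms by λ, we have Q(u_k)φ invariant as well"*) and block-field-gauge COVARIANCE ((4.17) *"and thus we have invariance in the previous
sense"*), so that the `Q_t`-hypotheses of the (5.1.1) theorems of this seat's gens 5–6 are DISCHARGED for the printed kernel.

statement-level skeleton of published theorems with citation tags; proofs where landed; nothing here is a claim about the Yang–Mills mass gap

PDF held: `paper:balaban1988-cmp114-bij-abelian-higgs-effective-action` (journal page = PDF page + 256); pp. 274, 277–278 [PDF 18, 21–22]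
read as images (r16's renders `HOME/lit-balaban-r16/renders/cmp114/original-p018-x2.png`, `original-p021-x2.png`, `original-p022-x2.png`).

CITATION HEADER (lean-in-tree rule).  Part of the lit-balaban TYPED SKELETON (HOME `run/shared/lean/pub/lit-balaban/`), PHASE-2 proof
seat p34 gen 7 (unit `lit-balaban-p34-g7`; TAKING line HOME/STATUS.md 2026-08-21T10:52:30Z, free-target protocol G.5-34(d), own lineage =
the C1/C2 renormalization-transformation line: `BIJ85RT33` (3.3), `BIJ85RT37Normalization` (3.7), `BIJ88Sect3Rescaling` (3.6)/(3.7),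
`BIJ88RT311Exists`, `BIJ88GaugeAverage`/`BIJ88RTIterated`, `BIJ88RT51GeneralStep`/`NoChange`/`BlockGauge`/`Unique` (gen 5),
`BIJ88RT51Density`/`Exists`/`Invariant` (gen 6)).  Rows served (support): `C2.Eq4.4`, `C2.Eq4.17`, `C2.Eq4.1` of
`HOME/lit-balaban-r18/ROWS-C2.md` (owner r18; the C2.Eq4.1 cell recorded *"(5.1.1)'s background-field kernel Q(u_k)φ is not this object,
p34 header NOT DONE (i)"*) and `C2.Eq5.1.1-5.1.4` / `C2.Eq5.2.9` of `HOME/lit-balaban-r16/ROWS-C2-part2.md` (owner r16).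

THE PRINTED TEXT (verbatim).  p. 274 [PDF 18]: *"The external gauge field appearing throughout the initial density is u_k. It depends on
all the u^{(j)} …; but in Λ̄₆^{(k−1)*} it simplifies to u_k = (Q^{s*}_ku) exp(−ie_kη𝒟_{k,loc}∂*Q^{e*}_k f^{(k)}), (4.2) … The form of u_k in
Λ̄₆^{(k−1)*c} is quite complicated … The configuration u_k on T_η gives a configuration ū_k on T₁^{(k)} by taking a product along the
bond in T₁^{(k)}, i.e., ū_{k,b} = u_k(⟨b₋, b₊⟩). (4.4)"*.  p. 277 [PDF 21], after (4.17): *"for λ a function on T₁^{(k)}. … The dependence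
of u_k and u and the u^{(j)} is such that the above transformations induce the gauge transformation u_{k,b} → u_{k,b} exp[−ie_kη(∂^ηQ′*_kλ)],
and thus we have invariance in the previous sense."*  p. 277–278, (5.1.1) *"… exp[−½aL⁻²⟨ψ − Q(u_k)φ, ψ − Q(u_k)φ⟩ − E^{(k)}] ρ′_k(u, φ,
{X_ω}, {u^{(j)}})"* and (5.1.4): *"Under gauge transformations λ of u, φ, u^{(j)} that vanish on points of T_L^{(k+1)}, we see that the
δ-functions and ρ′_k are invariant. Since u_k also transforms by λ, we have Q(u_k)φ invariant as well."*

THE READING (all carriers of record; nothing re-declared).  Levels of `Balaban1983to89.Setup` as in gens 5–6: `T_η = T^{(0)}` (`u_k :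
GaugeField P 0 U1`), the unit lattice `T₁^{(k)} = T^{(k)}` (`u`, `φ`), the block lattice `T_L^{(k+1)} = T^{(k+1)}` (`v`, `ψ`, `λ` of the
block-constant case).  `ū_k` = r18's `BIJ88Sect4Statements.barU k u_k` (the `k`-fold straight-line product; (4.4) `BIJ88Eq44OneStroke.barU_eq_lineProd`);
**`Q(u_k)φ := BIJ85BlockAveragesTorus.qCov (barU k u_k) φ`** — the average (2.6) of [2] on the unit lattice with the transports
`ū_k(Γ_{yx})` (the contour `Γ_{yx}` of unit-lattice bonds read in `T_η` is the concatenation of the lines `⟨b₋, b₊⟩`, so `u_k(Γ_{yx}) =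
ū_k(Γ_{yx})` by (4.4)); the background field ENTERS AS A MAP `u_k = uk({u^{(j)}}, u)` (p. 274 *"It depends on all the u^{(j)}"*); *"u_k
transforms by λ"* = `uk(τ{u^{(j)}}, u^λ) = (uk({u^{(j)}}, u))^{λ₀}` for a gauge transformation `λ₀` of `T_η` that RESTRICTS TO `λ` on the
points of `T₁^{(k)}` (`λ₀ ∘ embIter k = λ`; the printed `λ₀ = Q′*_kλ = λ∘(k-fold block map)` is one: `iterBlockOf_embIter`).  The companion
file `BIJ88RT51Background42` discharges this transformation law for the (4.2)-shaped backgrounds `u_k = (Q^{s*}_ku)·w(u)`.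

WHAT IS PROVED (kernel-checked; theorems only, no `def`, no `Prop`-valued fact; standard axioms).
* §1 **(4.4) + [2] (2.7)–(2.8): gauge covariance of `ū_k`, any gauge group** — `barU_gaugeAct`: `ū_k` of `u_k^{h}` is `(ū_k)^{h∘embIter k}`
  (the `k`-fold iterate of the tree's one-level `AveragingRT.axialAvg_covariant`; r18's `BIJ88Eq44OneStroke` recorded it NOT DONE);
  `iterBlockOf_embIter` (`B5Eq118OneStroke.iterBlockOf k ∘ embIter k = id`: the point of `T₁^{(k)}` over its own image in `T_η`);
  `barU_gaugeAct_iterBlockOf` (a transformation `λ∘iterBlockOf k = Q′*_kλ` of `T_η` acts on `ū_k` as `λ`); `barU_eq_iter_axial` and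
  `barU_qsstarGIter0` (`ū` of `Q^{s*}_ku` is `u`: p31's `BIJ85Eq453GaugeField.iter_axial_qsstarGIter0` read for `barU`); `measurable_barU`.
* §2 **the kernel `Q(ū_k)φ`**: `qCov_barU_gaugeAct` (general `λ₀`: a factor `λ₀(embIter k (corner y))`), `qCov_barU_pointed` ((5.1.4):
  INVARIANT when `λ₀` restricts to a pointed `λ`), `qCov_barU_blockGauge` ((4.17): COVARIANT, factor `g(y)`, when `λ₀` restricts to
  `g∘y`), `measurable_qCov_barU`, `measurable_qCov_barU_comp` (joint measurability in `({u^{(j)}}, u, φ)` from that of the map `uk`).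
* §3 **assembly** — the `Q_t`-hypotheses (`hQφ`, `hQφm`) of gen 5's `BIJ88RT51NoChange.isRT511_iff_isRT511Ax` ((5.1.4) *"no change is
  made"*), `BIJ88RT51BlockGauge.isRT511_blockGauge`/`isRT511Ax_blockGauge` ((4.17)/(5.2.9) covariance) and gen 6's
  `BIJ88RT51Invariant.exists_isRT511_jointInvariant`(`Ax`) (existence of an exactly block-gauge-invariant `ρ̃^L_{k+1}`) DISCHARGED for
  `Q_t := qCov (barU k (uk_t({u^{(j)}}, u))) ·` under the transformation law of the maps `uk_t` alone: `isRT511_iff_isRT511Ax_background`,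
  `isRT511_blockGauge_background`, `isRT511Ax_blockGauge_background`, `exists_isRT511_jointInvariant_background`,
  `exists_isRT511Ax_jointInvariant_background` (the last two with the PRINTED `Qu` of [2] (2.10), r18's `qU`).
NOT DONE HERE (honest scope).  The form of `u_k` in `Λ̄₆^{(k−1)*c}` (*"quite complicated"*, p. 274 — not printed in this paper) stays an
abstract map with the printed transformation law as hypothesis; the (4.2) form is the companion file; the corner-anchored contours of [2]
vs the centred lines of `Setup` (DIVERGENCE F3, as in `BIJ88Eq44OneStroke`); any bound.  Imports `BIJ88RT51Invariant` (gens 5–6 chain) and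
`BIJ88Eq44OneStroke` (Literature + Mathlib only); re-declares nothing.
-/

namespace Literature.MathematicalPhysics.QuantumFieldTheory.BalabanImbrieJaffe1984to88.BIJ88RT51Background

open Literature.MathematicalPhysics.QuantumFieldTheory.Balaban1983to89
open BIJ88Sect3Statements (U1 toC toC_one)
open BIJ85Sect1Model (HiggsField)
open BIJ85RT33 (JointInvariant twist)
open BIJ88RenormTransf311 (axialMeasure)
open BIJ85BlockAveragesTorus (corner qU qCov qCov_gaugeAct_twist measurable_qU measurable_qCov map_qU_fieldMeasure
  absolutelyContinuous_map_qU)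
open BIJ88InductiveForm41 (Prev prevMeasure)
open BIJ88BlockGauge417 (qU_gaugeAct_blockConst qCov_gaugeAct_blockConst)
open BIJ88RT51GeneralStep (IsRT511 IsRT511Ax IsPointed)
open BIJ88RT51NoChange (isRT511_iff_isRT511Ax qCov_pointed)
open BIJ88RT51BlockGauge (isRT511_blockGauge isRT511Ax_blockGauge)
open BIJ88RT51Invariant (exists_isRT511_jointInvariant exists_isRT511Ax_jointInvariant)
open BIJ88Sect4Statements (barU)
open BIJ88Eq44OneStroke (barU_succ)
open B15DeterminingSets (embIter)
open B5Eq118OneStroke (iterBlockOf iterBlockOf_succ)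
open BIJ85Eq453GaugeField (qsstarGIter0 iter_axial_qsstarGIter0)
open AveragingRT (axialAvg axialAvg_covariant measurable_axialAvg)
open GaugeField (gaugeAct)
open scoped BigOperators
open _root_.MeasureTheory _root_.MeasureTheory.Measure Function

noncomputable section

variable {P : Params}

/-! ## §1 (4.4): gauge covariance of `ū_k` (any gauge group) -/

section BarU

variable {G : Type*} [GaugeGroup G]

/-- kernel: the inclusion `T^{(k+1)} ⊂ T_η` is the inclusion `T^{(k)} ⊂ T_η` after the centre embedding `emb` (definitional).
[cite: BalabanImbrieJaffe1988, (4.4) p.274] -/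
theorem embIter_succ (k : ℕ) (y : Balaban1983to89.Site P (k+1)) : embIter (k+1) y = embIter k (emb y) := rfl

/-- **(4.4) under gauge transformations of `T_η`** ([2] (2.7) telescoping along `⟨b₋, b₊⟩`): for every gauge group, every gauge
transformation `h` of the η-lattice and every `u_k`, the unit-lattice field `ū_k` of `u_k^h` is the gauge transform of `ū_k` by `h`
restricted to the points of `T₁^{(k)}` (their images `embIter k` in `T_η`): `ū(u^h)_b = h(b₋) ū(u)_b h(b₊)^{−1}` — the `k`-fold iterate of
the tree's one-level `AveragingRT.axialAvg_covariant` (standing range `k ≤ m + K`). [cite: BalabanImbrieJaffe1988, (4.4) p.274] -/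
theorem barU_gaugeAct : ∀ (k : ℕ), k ≤ P.m + P.K → ∀ (h : GaugeTransf P 0 G) (W : GaugeField P 0 G),
    barU k (gaugeAct h W) = gaugeAct (fun y => h (embIter k y)) (barU k W)
  | 0, _, _, _ => rfl
  | k + 1, hk, h, W => by
    rw [barU_succ, barU_succ, barU_gaugeAct k (by omega) h W, axialAvg_covariant hk]
    rfl

/-- (4.4) under gauge transformations, bondwise: `ū(u^h)_b = h(b₋)·ū(u)_b·h(b₊)^{−1}` with the end-points read in `T_η`.
[cite: BalabanImbrieJaffe1988, (4.4) p.274] -/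
theorem barU_gaugeAct_apply {k : ℕ} (hk : k ≤ P.m + P.K) (h : GaugeTransf P 0 G) (W : GaugeField P 0 G) (b : PBond P k) :
    barU k (gaugeAct h W) b = h (embIter k b.src) * barU k W b * (h (embIter k b.tgt))⁻¹ := by
  rw [barU_gaugeAct k hk]
  rfl

/-- kernel: a point of `T₁^{(k)}` is the `k`-fold block point of its own image in `T_η` — `iterBlockOf k (embIter k y) = y` (p39's
base-`0` block map `B5Eq118OneStroke.iterBlockOf`; standing range). [cite: BalabanImbrieJaffe1988, (4.4) p.274] -/
theorem iterBlockOf_embIter : ∀ (k : ℕ), k ≤ P.m + P.K → ∀ y : Balaban1983to89.Site P k, iterBlockOf k (embIter k y) = y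
  | 0, _, _ => rfl
  | k + 1, hk, y => by
    rw [iterBlockOf_succ, embIter_succ, iterBlockOf_embIter k (by omega) (emb y), Balaban1983to89.Site.blockOf_emb hk]

/-- **`Q′*_kλ` acts on `ū_k` as `λ`**: the gauge transformation of `T_η` by `λ∘iterBlockOf k` (the pull-back of a unit-lattice `λ`,
constant on `k`-blocks — the `Q′*_kλ` of p. 277) transforms `ū_k` by `λ` itself (any gauge group; standing range).
[cite: BalabanImbrieJaffe1988, (4.17) p.277] -/
theorem barU_gaugeAct_iterBlockOf {k : ℕ} (hk : k ≤ P.m + P.K) (g : GaugeTransf P k G) (W : GaugeField P 0 G) :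
    barU k (gaugeAct (fun x => g (iterBlockOf k x)) W) = gaugeAct g (barU k W) := by
  rw [barU_gaugeAct k hk]
  congr 1
  funext y
  exact congrArg g (iterBlockOf_embIter k hk y)

/-- kernel: r18's `barU k` IS the `k`-fold iterate `Setup.Averaging.iter` of the tree's straight-line averaging `AveragingRT.axial` (same
recursion). [cite: BalabanImbrieJaffe1988, (4.4) p.274] -/
theorem barU_eq_iter_axial : ∀ k : ℕ,
    (barU k : GaugeField P 0 G → GaugeField P k G) = Averaging.iter (fun j => (AveragingRT.axial : Averaging P j G)) k
  | 0 => rfl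
  | k + 1 => by
    funext U
    rw [barU_succ]
    show axialAvg (barU k U) = (AveragingRT.axial : Averaging P k G).avg
      (Averaging.iter (fun j => (AveragingRT.axial : Averaging P j G)) k U)
    rw [barU_eq_iter_axial k, AveragingRT.axial_avg]

/-- **`ū` of `Q^{s*}_ku` is `u`**: the `k`-fold straight-line product (4.4) of the pulled-back configuration `Q^{s*}_ku` of [2] (4.5.3)
(p31's base-`0` `qsstarGIter0`) gives back `u` — p31's section property `iter_axial_qsstarGIter0` read for `barU`; so for a background
`u_k = Q^{s*}_ku` without correction factor `Q(u_k)φ` IS the kernel `Q(u)φ` of the first step (3.11) (standing range).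
[cite: BalabanImbrieJaffe1988, (4.4) p.274] -/
theorem barU_qsstarGIter0 {k : ℕ} (hk : k ≤ P.m + P.K) (V : GaugeField P k G) : barU k (qsstarGIter0 k V) = V := by
  rw [barU_eq_iter_axial]
  exact iter_axial_qsstarGIter0 k hk V

variable [MeasurableSpace G] [MeasurableMul₂ G]

/-- kernel: `u_k ↦ ū_k` is measurable (finite products of bond variables). [cite: BalabanImbrieJaffe1988, (4.4) p.274] -/
theorem measurable_barU : ∀ k : ℕ, Measurable (barU k : GaugeField P 0 G → GaugeField P k G)
  | 0 => measurable_id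
  | k + 1 => by
    rw [show (barU (k+1) : GaugeField P 0 G → GaugeField P (k+1) G) = fun U => axialAvg (barU k U) from
      funext fun U => barU_succ k U]
    exact measurable_axialAvg.comp (measurable_barU k)

end BarU

/-! ## §2 The kernel `Q(u_k)φ = Q(ū_k)φ`: its transformation under *"u_k transforms by λ"* -/

section Kernel

variable {k : ℕ}

/-- **`Q(u_k)φ` under a gauge transformation `λ₀` of the background field**: `Q(ū(u_k^{λ₀}))(λφ)(y) = λ₀(corner y)·(Q(ū_k)φ)(y)` when
`φ` is rotated by the restriction `λ = λ₀∘embIter k` of `λ₀` to the unit lattice ([2] (2.8) `qCov_gaugeAct_twist` for `ū_k`, §1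
`barU_gaugeAct`; standing range). [cite: BalabanImbrieJaffe1988, (5.1.4) p.278] -/
theorem qCov_barU_gaugeAct (hk : k + 1 ≤ P.m + P.K) (h : GaugeTransf P 0 U1) (W : GaugeField P 0 U1) (φ : HiggsField P k)
    (y : Balaban1983to89.Site P (k+1)) :
    qCov (barU k (gaugeAct h W)) (twist (fun x => h (embIter k x)) φ) y = toC (h (embIter k (corner y))) * qCov (barU k W) φ y := by
  rw [barU_gaugeAct k (by omega) h W, qCov_gaugeAct_twist hk]

/-- **(5.1.4) p. 278, verbatim: *"Since u_k also transforms by λ, we have Q(u_k)φ invariant as well"* — PROVED for the concrete kernel**: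
if `u_k` is transformed by a gauge transformation `λ₀` of `T_η` restricting on the points of `T₁^{(k)}` to a `λ` that is trivial at the
block-lattice points (`IsPointed`), and `φ` by `λ`, then `Q(ū_k)φ` is unchanged (the transports `ū_k(Γ_{yx})` pick up `λ(corner y) = 1`
and `λ(x)^{−1}`, the latter cancelling against `φ(x) ↦ λ(x)φ(x)`; standing range). [cite: BalabanImbrieJaffe1988, (5.1.4) p.278] -/
theorem qCov_barU_pointed (hk : k + 1 ≤ P.m + P.K) {g : GaugeTransf P k U1} (hg : IsPointed g) {h : GaugeTransf P 0 U1}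
    (hh : ∀ x : Balaban1983to89.Site P k, h (embIter k x) = g x) (W : GaugeField P 0 U1) (φ : HiggsField P k) :
    qCov (barU k (gaugeAct h W)) (twist g φ) = qCov (barU k W) φ := by
  rw [barU_gaugeAct k (by omega) h W, show (fun y => h (embIter k y)) = g from funext hh]
  exact qCov_pointed hk hg (barU k W) φ

/-- **(4.17) p. 277, verbatim: *"the above transformations induce the gauge transformation u_{k,b} → u_{k,b}exp[−ie_kη(∂^ηQ′*_kλ)], and
thus we have invariance in the previous sense"* — the COVARIANCE of the concrete kernel**: if `u_k` is transformed by a gauge transformation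
`λ₀` of `T_η` restricting on the points of `T₁^{(k)}` to the block-constant `g∘y` (`g : T_L^{(k+1)} → U(1)`; the printed `Q′*_kλ`), and `φ`
by `g∘y`, then `Q(ū_k)φ ↦ g·Q(ū_k)φ` — so `⟨ψ − Q(u_k)φ, ψ − Q(u_k)φ⟩` is invariant when `ψ ↦ gψ` (r18's `qCov_gaugeAct_blockConst` for
`ū_k`; standing range). [cite: BalabanImbrieJaffe1988, (4.17) p.277] -/
theorem qCov_barU_blockGauge (hk : k + 1 ≤ P.m + P.K) (g : GaugeTransf P (k+1) U1) {h : GaugeTransf P 0 U1}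
    (hh : ∀ x : Balaban1983to89.Site P k, h (embIter k x) = g (blockOf x)) (W : GaugeField P 0 U1) (φ : HiggsField P k) :
    qCov (barU k (gaugeAct h W)) (twist (fun x => g (blockOf x)) φ) = twist g (qCov (barU k W) φ) := by
  rw [barU_gaugeAct k (by omega) h W, show (fun y => h (embIter k y)) = (fun x => g (blockOf x)) from funext hh]
  exact qCov_gaugeAct_blockConst hk g (barU k W) φ

/-- kernel: `(u_k, φ) ↦ Q(ū_k)φ` is jointly measurable (r18's `measurable_qCov` after `measurable_barU`).
[cite: BalabanImbrieJaffe1988, (5.1.1) p.277] -/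
theorem measurable_qCov_barU (k : ℕ) : Measurable fun p : GaugeField P 0 U1 × HiggsField P k => qCov (barU k p.1) p.2 := by
  -- (`simpa … comp_def`: a direct `exact` would unfold `qCov` in the unifier — the declaration-level `whnf` time-out of gens 5–6)
  have h1 : Measurable fun p : GaugeField P 0 U1 × HiggsField P k => (barU k p.1, p.2) :=
    ((measurable_barU k).comp measurable_fst).prodMk measurable_snd
  have h2 := measurable_qCov.comp h1
  simpa only [Function.comp_def, Function.uncurry] using h2

/-- kernel: for a jointly measurable background map `({u^{(j)}}, u) ↦ u_k`, the kernel `({u^{(j)}}, u, φ) ↦ Q(ū_k)φ` of (5.1.1) is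
jointly measurable — the `hQφm` hypothesis of gens 5–6. [cite: BalabanImbrieJaffe1988, (5.1.1) p.277] -/
theorem measurable_qCov_barU_comp {uk : Prev P k → GaugeField P k U1 → GaugeField P 0 U1}
    (huk : Measurable fun q : Prev P k × GaugeField P k U1 => uk q.1 q.2) :
    Measurable fun p : Prev P k × (GaugeField P k U1 × HiggsField P k) => qCov (barU k (uk p.1 p.2.1)) p.2.2 := by
  have h1 : Measurable fun p : Prev P k × (GaugeField P k U1 × HiggsField P k) => (uk p.1 p.2.1, p.2.2) :=
    (huk.comp (measurable_fst.prodMk (measurable_fst.comp measurable_snd))).prodMk (measurable_snd.comp measurable_snd)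
  have h2 := (measurable_qCov_barU k).comp h1
  simpa only [Function.comp_def] using h2

end Kernel

/-! ## §3 Assembly: the `Q_t`-hypotheses of the (5.1.1) theorems DISCHARGED for the concrete kernel -/

section Assembly

variable {k : ℕ} {ι : Type*} {terms : Finset ι} {Qu : GaugeField P k U1 → GaugeField P (k+1) U1}
variable {uk : ι → Prev P k → GaugeField P k U1 → GaugeField P 0 U1} {a : ℝ}
variable {ρ' : ι → Prev P k → GaugeField P k U1 → HiggsField P k → ℂ}

/-- **(5.1.4) for (5.1.1) with the CONCRETE `Q(u_k)φ`** — gen 5's `isRT511_iff_isRT511Ax` with its kernel hypotheses discharged: if `Qu` is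
measurable and pointed-invariant, the term densities `ρ′_t` are jointly measurable and invariant under `({u^{(j)}}, u, φ) ↦ (τ_t(λ){u^{(j)}},
u^λ, λφ)` for pointed `λ` (`τ_t(λ)` `Π𝒟u^{(j)}`-preserving), and the background maps `uk_t` are jointly measurable and *"transform by λ"*
(`uk_t(τ_t(λ){u^{(j)}}, u^λ) = uk_t({u^{(j)}}, u)^{λ₀}` with `λ₀ ∘ embIter k = λ`), then `ρ̃` satisfies (5.1.1) with the kernels
`Q_t = Q(ū(uk_t))φ` iff it satisfies it with `δ_{Ax}(u)` inserted (standing range). [cite: BalabanImbrieJaffe1988, (5.1.4) p.278] -/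
theorem isRT511_iff_isRT511Ax_background (hk : k + 1 ≤ P.m + P.K) (hQum : Measurable Qu)
    (hukm : ∀ t ∈ terms, Measurable fun q : Prev P k × GaugeField P k U1 => uk t q.1 q.2)
    (hρm : ∀ t ∈ terms, Measurable fun p : Prev P k × (GaugeField P k U1 × HiggsField P k) => ρ' t p.1 p.2.1 p.2.2)
    (hQu : ∀ g : GaugeTransf P k U1, IsPointed g → ∀ U, Qu (gaugeAct g U) = Qu U)
    (τ : ι → GaugeTransf P k U1 → Prev P k ≃ᵐ Prev P k)
    (hτ : ∀ t ∈ terms, ∀ g : GaugeTransf P k U1, IsPointed g → MeasurePreserving (τ t g) (prevMeasure P k) (prevMeasure P k))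
    (hρ : ∀ t ∈ terms, ∀ g : GaugeTransf P k U1, IsPointed g → ∀ prev U φ,
      ρ' t (τ t g prev) (gaugeAct g U) (twist g φ) = ρ' t prev U φ)
    (H : ι → GaugeTransf P k U1 → GaugeTransf P 0 U1)
    (hH : ∀ t ∈ terms, ∀ g : GaugeTransf P k U1, IsPointed g → ∀ x : Balaban1983to89.Site P k, H t g (embIter k x) = g x)
    (huk : ∀ t ∈ terms, ∀ g : GaugeTransf P k U1, IsPointed g → ∀ prev U,
      uk t (τ t g prev) (gaugeAct g U) = gaugeAct (H t g) (uk t prev U))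
    (ρL : GaugeField P (k+1) U1 → HiggsField P (k+1) → ℂ) :
    IsRT511 terms Qu (fun t prev U φ => qCov (barU k (uk t prev U)) φ) a ρ' ρL ↔
      IsRT511Ax terms Qu (fun t prev U φ => qCov (barU k (uk t prev U)) φ) a ρ' ρL :=
  isRT511_iff_isRT511Ax hk hQum (fun t ht => measurable_qCov_barU_comp (hukm t ht)) hρm hQu τ hτ hρ
    (fun t ht g hg prev U φ => by
      show qCov (barU k (uk t (τ t g prev) (gaugeAct g U))) (twist g φ) = qCov (barU k (uk t prev U)) φ
      rw [huk t ht g hg prev U]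
      exact qCov_barU_pointed hk hg (hH t ht g hg) (uk t prev U) φ) ρL

/-- **Block field gauge covariance of (5.1.1) with the CONCRETE `Q(u_k)φ`** — gen 5's `isRT511_blockGauge` with its kernel hypothesis
discharged: `Qu` block-gauge covariant, `ρ′_t` invariant under `({u^{(j)}}, u, φ) ↦ (τ_t(g){u^{(j)}}, u^{g∘y}, (g∘y)φ)` (`τ_t(g)`
`Π𝒟u^{(j)}`-preserving), and the background maps transforming by a `λ₀` with `λ₀ ∘ embIter k = g∘y` (the induced transformation of p. 277)
⟹ `(v, ψ) ↦ ρ̃(v^g, gψ)` satisfies (5.1.1) whenever `ρ̃` does (standing range). [cite: BalabanImbrieJaffe1988, (4.17) p.277] -/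
theorem isRT511_blockGauge_background (hk : k + 1 ≤ P.m + P.K)
    (hQu : ∀ (g : GaugeTransf P (k+1) U1) U, Qu (gaugeAct (fun x => g (blockOf x)) U) = gaugeAct g (Qu U))
    (τ : ι → GaugeTransf P (k+1) U1 → Prev P k ≃ᵐ Prev P k)
    (hτ : ∀ t ∈ terms, ∀ g, MeasurePreserving (τ t g) (prevMeasure P k) (prevMeasure P k))
    (hρ : ∀ t ∈ terms, ∀ (g : GaugeTransf P (k+1) U1) prev U φ,
      ρ' t (τ t g prev) (gaugeAct (fun x => g (blockOf x)) U) (twist (fun x => g (blockOf x)) φ) = ρ' t prev U φ)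
    (H : ι → GaugeTransf P (k+1) U1 → GaugeTransf P 0 U1)
    (hH : ∀ t ∈ terms, ∀ (g : GaugeTransf P (k+1) U1) (x : Balaban1983to89.Site P k), H t g (embIter k x) = g (blockOf x))
    (huk : ∀ t ∈ terms, ∀ (g : GaugeTransf P (k+1) U1) prev U,
      uk t (τ t g prev) (gaugeAct (fun x => g (blockOf x)) U) = gaugeAct (H t g) (uk t prev U))
    {ρL : GaugeField P (k+1) U1 → HiggsField P (k+1) → ℂ}
    (h : IsRT511 terms Qu (fun t prev U φ => qCov (barU k (uk t prev U)) φ) a ρ' ρL) (g : GaugeTransf P (k+1) U1) :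
    IsRT511 terms Qu (fun t prev U φ => qCov (barU k (uk t prev U)) φ) a ρ' (fun v ψ => ρL (gaugeAct g v) (twist g ψ)) :=
  isRT511_blockGauge hQu τ hτ hρ (fun t ht g prev U φ => by
    show qCov (barU k (uk t (τ t g prev) (gaugeAct (fun x => g (blockOf x)) U))) (twist (fun x => g (blockOf x)) φ) =
      twist g (qCov (barU k (uk t prev U)) φ)
    rw [huk t ht g prev U]
    exact qCov_barU_blockGauge hk g (hH t ht g) (uk t prev U) φ) h g

/-- The same WITH the axial gauge conditions (5.1.4) inserted (gen 5's `isRT511Ax_blockGauge`). [cite: BalabanImbrieJaffe1988, (4.17) p.277] -/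
theorem isRT511Ax_blockGauge_background (hk : k + 1 ≤ P.m + P.K)
    (hQu : ∀ (g : GaugeTransf P (k+1) U1) U, Qu (gaugeAct (fun x => g (blockOf x)) U) = gaugeAct g (Qu U))
    (τ : ι → GaugeTransf P (k+1) U1 → Prev P k ≃ᵐ Prev P k)
    (hτ : ∀ t ∈ terms, ∀ g, MeasurePreserving (τ t g) (prevMeasure P k) (prevMeasure P k))
    (hρ : ∀ t ∈ terms, ∀ (g : GaugeTransf P (k+1) U1) prev U φ,
      ρ' t (τ t g prev) (gaugeAct (fun x => g (blockOf x)) U) (twist (fun x => g (blockOf x)) φ) = ρ' t prev U φ)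
    (H : ι → GaugeTransf P (k+1) U1 → GaugeTransf P 0 U1)
    (hH : ∀ t ∈ terms, ∀ (g : GaugeTransf P (k+1) U1) (x : Balaban1983to89.Site P k), H t g (embIter k x) = g (blockOf x))
    (huk : ∀ t ∈ terms, ∀ (g : GaugeTransf P (k+1) U1) prev U,
      uk t (τ t g prev) (gaugeAct (fun x => g (blockOf x)) U) = gaugeAct (H t g) (uk t prev U))
    {ρL : GaugeField P (k+1) U1 → HiggsField P (k+1) → ℂ}
    (h : IsRT511Ax terms Qu (fun t prev U φ => qCov (barU k (uk t prev U)) φ) a ρ' ρL) (g : GaugeTransf P (k+1) U1) :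
    IsRT511Ax terms Qu (fun t prev U φ => qCov (barU k (uk t prev U)) φ) a ρ' (fun v ψ => ρL (gaugeAct g v) (twist g ψ)) :=
  isRT511Ax_blockGauge hk hQu τ hτ hρ (fun t ht g prev U φ => by
    show qCov (barU k (uk t (τ t g prev) (gaugeAct (fun x => g (blockOf x)) U))) (twist (fun x => g (blockOf x)) φ) =
      twist g (qCov (barU k (uk t prev U)) φ)
    rw [huk t ht g prev U]
    exact qCov_barU_blockGauge hk g (hH t ht g) (uk t prev U) φ) h g

/-- **EXISTENCE OF AN EXACTLY BLOCK-FIELD GAUGE INVARIANT `ρ̃^L_{k+1}` FOR (5.1.1) WITH THE CONCRETE `Q(u_k)φ` AND THE PRINTED `Qu`** ([2]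
(2.10), r18's `qU`: Haar regularity `map_qU_fieldMeasure`, covariance `qU_gaugeAct_blockConst`): gen 6's `exists_isRT511_jointInvariant` with
every hypothesis on the block averages discharged — only the measurability / integrability / invariance of the term densities `ρ′_t` and
the measurability and transformation law of the background maps `uk_t` remain (`a > 0`, `d ≥ 2`, standing range).
[cite: BalabanImbrieJaffe1988, (5.1.1) p.277] -/
theorem exists_isRT511_jointInvariant_background (hk : k + 1 ≤ P.m + P.K) (ha : 0 < a) (hd : 2 ≤ P.d)
    (hukm : ∀ t ∈ terms, Measurable fun q : Prev P k × GaugeField P k U1 => uk t q.1 q.2)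
    (hρm : ∀ t ∈ terms, Measurable fun p : Prev P k × (GaugeField P k U1 × HiggsField P k) => ρ' t p.1 p.2.1 p.2.2)
    (hρi : ∀ t ∈ terms, Integrable (fun q : GaugeField P k U1 × (Prev P k × HiggsField P k) => ρ' t q.2.1 q.1 q.2.2)
      ((fieldMeasure P k U1).prod ((prevMeasure P k).prod volume)))
    (τ : ι → GaugeTransf P (k+1) U1 → Prev P k ≃ᵐ Prev P k)
    (hτ : ∀ t ∈ terms, ∀ g, MeasurePreserving (τ t g) (prevMeasure P k) (prevMeasure P k))
    (hρ : ∀ t ∈ terms, ∀ (g : GaugeTransf P (k+1) U1) prev U φ,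
      ρ' t (τ t g prev) (gaugeAct (fun x => g (blockOf x)) U) (twist (fun x => g (blockOf x)) φ) = ρ' t prev U φ)
    (H : ι → GaugeTransf P (k+1) U1 → GaugeTransf P 0 U1)
    (hH : ∀ t ∈ terms, ∀ (g : GaugeTransf P (k+1) U1) (x : Balaban1983to89.Site P k), H t g (embIter k x) = g (blockOf x))
    (huk : ∀ t ∈ terms, ∀ (g : GaugeTransf P (k+1) U1) prev U,
      uk t (τ t g prev) (gaugeAct (fun x => g (blockOf x)) U) = gaugeAct (H t g) (uk t prev U)) :
    ∃ ρL : GaugeField P (k+1) U1 → HiggsField P (k+1) → ℂ,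
      IsRT511 terms qU (fun t prev U φ => qCov (barU k (uk t prev U)) φ) a ρ' ρL ∧ JointInvariant ρL ∧ Measurable (uncurry ρL) ∧
        Integrable (uncurry ρL) ((fieldMeasure P (k+1) U1).prod volume) :=
  exists_isRT511_jointInvariant ha hd measurable_qU (Measure.absolutelyContinuous_of_eq (map_qU_fieldMeasure hk))
    (fun t ht => measurable_qCov_barU_comp (hukm t ht)) hρm hρi (qU_gaugeAct_blockConst hk) τ hτ hρ
    (fun t ht g prev U φ => by
      show qCov (barU k (uk t (τ t g prev) (gaugeAct (fun x => g (blockOf x)) U))) (twist (fun x => g (blockOf x)) φ) =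
        twist g (qCov (barU k (uk t prev U)) φ)
      rw [huk t ht g prev U]
      exact qCov_barU_blockGauge hk g (hH t ht g) (uk t prev U) φ)

/-- The axial version (gen 6's `exists_isRT511Ax_jointInvariant`; Haar regularity in the axial gauge `absolutelyContinuous_map_qU`).
[cite: BalabanImbrieJaffe1988, (5.1.4) p.278] -/
theorem exists_isRT511Ax_jointInvariant_background (hk : k + 1 ≤ P.m + P.K) (ha : 0 < a) (hd : 2 ≤ P.d)
    (hukm : ∀ t ∈ terms, Measurable fun q : Prev P k × GaugeField P k U1 => uk t q.1 q.2)
    (hρm : ∀ t ∈ terms, Measurable fun p : Prev P k × (GaugeField P k U1 × HiggsField P k) => ρ' t p.1 p.2.1 p.2.2)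
    (hρi : ∀ t ∈ terms, Integrable (fun q : GaugeField P k U1 × (Prev P k × HiggsField P k) => ρ' t q.2.1 q.1 q.2.2)
      ((axialMeasure P k U1).prod ((prevMeasure P k).prod volume)))
    (τ : ι → GaugeTransf P (k+1) U1 → Prev P k ≃ᵐ Prev P k)
    (hτ : ∀ t ∈ terms, ∀ g, MeasurePreserving (τ t g) (prevMeasure P k) (prevMeasure P k))
    (hρ : ∀ t ∈ terms, ∀ (g : GaugeTransf P (k+1) U1) prev U φ,
      ρ' t (τ t g prev) (gaugeAct (fun x => g (blockOf x)) U) (twist (fun x => g (blockOf x)) φ) = ρ' t prev U φ)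
    (H : ι → GaugeTransf P (k+1) U1 → GaugeTransf P 0 U1)
    (hH : ∀ t ∈ terms, ∀ (g : GaugeTransf P (k+1) U1) (x : Balaban1983to89.Site P k), H t g (embIter k x) = g (blockOf x))
    (huk : ∀ t ∈ terms, ∀ (g : GaugeTransf P (k+1) U1) prev U,
      uk t (τ t g prev) (gaugeAct (fun x => g (blockOf x)) U) = gaugeAct (H t g) (uk t prev U)) :
    ∃ ρL : GaugeField P (k+1) U1 → HiggsField P (k+1) → ℂ,
      IsRT511Ax terms qU (fun t prev U φ => qCov (barU k (uk t prev U)) φ) a ρ' ρL ∧ JointInvariant ρL ∧ Measurable (uncurry ρL) ∧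
        Integrable (uncurry ρL) ((fieldMeasure P (k+1) U1).prod volume) :=
  exists_isRT511Ax_jointInvariant hk ha hd measurable_qU (absolutelyContinuous_map_qU hk)
    (fun t ht => measurable_qCov_barU_comp (hukm t ht)) hρm hρi (qU_gaugeAct_blockConst hk) τ hτ hρ
    (fun t ht g prev U φ => by
      show qCov (barU k (uk t (τ t g prev) (gaugeAct (fun x => g (blockOf x)) U))) (twist (fun x => g (blockOf x)) φ) =
        twist g (qCov (barU k (uk t prev U)) φ)
      rw [huk t ht g prev U]
      exact qCov_barU_blockGauge hk g (hH t ht g) (uk t prev U) φ)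

end Assembly

end

end Literature.MathematicalPhysics.QuantumFieldTheory.BalabanImbrieJaffe1984to88.BIJ88RT51Background
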